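import Literature.Computability.Complexity.ProbabilisticClasses
import Literature.Computability.Complexity.PolyHierarchy
import Literature.Computability.Complexity.Space
import HarnessLib

-- provenance: harness21/H21/H21/Statements/QuantumAdvantage/ClassicalClasses.lean @ 42c9a31 (interim HEAD d8f2665); M5 mechanical rewrite
/-!
# Quantum advantage: the classical randomized classes

Family `quantum-advantage` (group G01, trunk `CplxCore`), statement `quantum-advantage.S25`.

The quantum-advantage family compares `BQP` with the classical randomized classes. This file
records, in the family namespace `Literature.QuantumAdvantage`, the classical side:

* `quantum-advantage.S25` `mem_BPP_iff_gill`: Gill's machine definition of `BPP` — a language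
  `L` is in `BPP` iff some probabilistic Turing machine with a coin tape, running in polynomial
  time on *every* input and *every* coin sequence (equivalently: a deterministic polynomial-time
  machine on the pair `(x, r)`, which is exactly `RandAlg.IsPolyTime`), using exactly `q |x|`
  coins for a polynomial `q`, outputs the correct bit `[x ∈ L]` with error probability at most
  `1/3` on every input. In H21, `BPP := bp P` is the
  operator form (`Literature.Computability.Complexity.BPP`), so S25 is a characterisation theorem; it is the prelude
  lemma `Literature.Computability.Complexity.mem_BPP_iff_randAlg` re-exported under the inventory id.
* Sanity inclusions consumed by the later `BQP` sandwich statements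
  (`P ⊆ BPP ⊆ BQP ⊆ PP ⊆ PSPACE`): `BPP_subset_PSPACE`, `PP_subset_PSPACE` (Gill 1977) and the
  Sipser–Gács–Lautemann theorem `BPP_subset_SigmaP_two_inter_PiP_two` (`BPP ⊆ Σ₂ᵖ ∩ Π₂ᵖ`).
  Toda's theorem `PH ⊆ P^{#P}` belongs to a different family and is deliberately not stated here.

## Mathlib / H21 dependencies

Mathlib has no complexity classes (grep `BPP`, `PSPACE`, `Lautemann`, `Sipser` in Mathlib: no
hits; only `Turing.TM2ComputableInPolyTime`). Everything is stated with the accepted H21 prelude: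
`Literature.Computability.Complexity.BPP`, `PP`, `PSPACE`, `SigmaP`, `PiP`, `RandAlg`, `RandAlg.IsPolyTime`,
`RandAlg.pr`. Nothing is redefined; this file contains theorems only (all proofs `sorry` except
S25, which is proved from the (sorried) prelude lemma `mem_BPP_iff_randAlg`).

## Design notes

* Statement-file rules (outline D7): `namespace Literature.QuantumAdvantage`, `open Literature.CplxCore`;
  intersections of classes `Set (Language Bool)` use `∩`.
* In S25 the coin budget is *literally* a polynomial `q` (Arora–Barak Def. 7.3: "`p(|x|)`
  random bits"), not merely polynomially bounded as in `RandAlg.IsPolyTime`; otherwise a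
  non-computable `coinLen` read off from `|r|` would break the `←` direction (see the prelude
  docstring of `mem_BPP_iff_randAlg`).
* In S25 the success event is the singleton `{L.boolIndicator x} : Set Bool`, i.e. "the output
  bit equals `[x ∈ L]`"; the input encoder is `id` (inputs are bit strings) and the output
  encoder is Mathlib's `Computability.encodeBool`.

## References

* J. Gill, *Computational complexity of probabilistic Turing machines*, SIAM J. Comput. 6
  (1977), §2 and Def. 5.2 (BPP), Thm. 6.6 area (`PP ⊆ PSPACE`).
* M. Sipser, *A complexity theoretic approach to randomness*, STOC 1983; P. Gács (ibid.);
  C. Lautemann, *BPP and the polynomial hierarchy*, Inform. Process. Lett. 17 (1983).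
* S. Arora, B. Barak, *Computational Complexity: A Modern Approach*, CUP 2009, Def. 7.2–7.3,
  Thm. 7.15 (`BPP ⊆ Σ₂ᵖ ∩ Π₂ᵖ`), §7.5.2 and Ex. 7.7 (`BPP ⊆ PP ⊆ PSPACE`).
* summits/fw-bqp/SUMMIT.md (quantum-advantage family summit).
-/

namespace Literature.Computability.QuantumComplexity

open Complexity _root_.Computability

/-- **quantum-advantage.S25** (Gill's definition of `BPP`; summits/fw-bqp/SUMMIT.md; Gill 1977,
§2 and Def. 5.2; Arora–Barak 2009, Def. 7.2 ↔ Def. 7.3). A language `L ⊆ {0,1}*` is in `BPP`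
iff there is a probabilistic Turing machine with a coin tape — presented as a deterministic
algorithm `A.run x r` of the input `x` and the coin string `r` with a polynomial coin budget —
that runs in polynomial time on every input and every coin sequence (`A.IsPolyTime id
encodeBool`: the map `(x, r) ↦ A.run x r` is deterministic polynomial time on `boolPair x r`),
tosses exactly `q |x|` coins for a polynomial `q`, and whose output bit equals `[x ∈ L]` with
probability at least `2/3` (error `≤ 1/3`) on every input `x`. This is
`Literature.Computability.Complexity.mem_BPP_iff_randAlg` under the inventory id. [cite: Gill1977, §2 and Def. 5.2] -/
def mem_BPP_iff_gill : Prop :=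
  ∀ (L : Language Bool),
    L ∈ BPP ↔ ∃ A : RandAlg (List Bool) Bool,
      A.IsPolyTime id encodeBool ∧ (∃ q : Polynomial ℕ, ∀ n, A.coinLen n = q.eval n) ∧
        ∀ x : List Bool, 2 / 3 ≤ A.pr id x {L.boolIndicator x}

/- interim proof relied on results that are now named facts (D-0014); demoted to a fact by the M5 import, proof preserved:
:=
  mem_BPP_iff_randAlg
-/

/-- `BPP ⊆ PSPACE`: enumerate all coin strings of length `coinLen |x|` in polynomial space,
count the accepting ones and compare with `2/3`. [Gill 1977, §6; Arora–Barak 2009, Ex. 7.7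
(`BPP ⊆ PP ⊆ PSPACE`)] [cite: Gill1977, §6] -/
def BPP_subset_PSPACE : Prop :=
  BPP ⊆ PSPACE

/-- `PP ⊆ PSPACE`: enumerate all coin strings in polynomial space and take the majority vote.
[Gill 1977, §6 (`PP ⊆ PSPACE`); Arora–Barak 2009, Ex. 7.7] [cite: Gill1977, §6 ( PP ⊆ PSPACE] -/
def PP_subset_PSPACE : Prop :=
  PP ⊆ PSPACE

/-- The Sipser–Gács–Lautemann theorem: `BPP ⊆ Σ₂ᵖ ∩ Π₂ᵖ`. After error reduction to `2^{-n}`,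
`x ∈ L` iff there exist polynomially many shifts `u₁, …, u_k` such that for every coin string
`r` some `M(x, r ⊕ uᵢ)` accepts; this is a `Σ₂ᵖ` predicate, and `BPP` is closed under
complement. [Sipser 1983; Lautemann 1983; Arora–Barak 2009, Thm. 7.15] [cite: Sipser1983] -/
def BPP_subset_SigmaP_two_inter_PiP_two : Prop :=
  BPP ⊆ SigmaP 2 ∩ PiP 2

end Literature.Computability.QuantumComplexity
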